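import Literature.Computability.Learning.EvalFP
import Literature.Computability.Learning.PAC
import Literature.Computability.Complexity.PairPlumbing
import Mathlib.NumberTheory.Bertrand
import HarnessLib

/-!
# Parameters of the CIKK learner as string functions

Machine-layer instalment (M8b) of the decomposition of the named fact
`Literature.Computability.Learning.cikk_natural_implies_learning` (CIKK 2016, Thm. 5.1): the
numerical parameters of the learner as plain functions (`prm…`, the ONLY place where the
constants live; the analysis files prove inequalities about them) and as unary string functions
in `FP` (exponentially large quantities are computed capped at a given unary bound, which the
coin padding makes large enough).

* `prmS n a b = size₂(n+a+b+2)`, `prmKappa s ℓ = 3s + size₂ ℓ + 30`, `prmK = 2^κ`, `prmKK = κ+2ℓ+8`,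
  `prmT`, `prmReps`, `prmM`, `prmQ n' =` the least prime `≥ n'`;
* bricks `uaddFn`, `pow2CapFn ⟨1^C, 1^e⟩ = 1^{min(2^e, C)}`, `isPrimeFn`, `leastPrimeFn`, and the
  parameter bricks with their values.

## References

* M. Carmosino, R. Impagliazzo, V. Kabanets, A. Kolokolova, *Learning algorithms from natural
  proofs*, CCC 2016, §5 (parameters of the complete algorithm) [CarmosinoImpagliazzoKabanetsKolokolova2016].
-/

open Polynomial

namespace Literature.Computability.Learning

open Literature.Computability.Complexity Literature.Computability.Complexity.Brick
  Literature.Computability.Complexity.Plumb _root_.Computability Finset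

/-! ### The parameters (plain functions) -/

/-- `s = size₂(n + a + b + 2)` (a logarithmic scale parameter, `2^s > n+a+b+2`). [folklore] -/
def prmS (n a b : ℕ) : ℕ := Nat.size (n + a + b + 2)

/-- `κ = 3s + size₂ ℓ + 30` (`k = 2^κ` is polynomial in `2^s` and `ℓ`). [cite: CarmosinoImpagliazzoKabanetsKolokolova2016, §5] -/
def prmKappa (s ℓ : ℕ) : ℕ := 3 * s + Nat.size ℓ + 30

/-- `k = 2^κ`, the direct-product arity. [cite: CarmosinoImpagliazzoKabanetsKolokolova2016, §5] -/
def prmK (s ℓ : ℕ) : ℕ := 2 ^ prmKappa s ℓ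

/-- `kk = κ + 2ℓ + 8`, the number of GL seeds (`2^kk = 256 k L²`). [cite: CarmosinoImpagliazzoKabanetsKolokolova2016, §5] -/
def prmKK (s ℓ : ℕ) : ℕ := prmKappa s ℓ + 2 * ℓ + 8

/-- `t = 2^{κ + 3ℓ + s + 22}`, the number of DP sampling steps. [cite: CarmosinoImpagliazzoKabanetsKolokolova2016, §5] -/
def prmT (s ℓ : ℕ) : ℕ := 2 ^ (prmKappa s ℓ + 3 * ℓ + s + 22)

/-- `Reps = 2^{2κ + 7ℓ + s + 40}`, the number of runs per level. [cite: CarmosinoImpagliazzoKabanetsKolokolova2016, §5] -/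
def prmReps (s ℓ : ℕ) : ℕ := 2 ^ (2 * prmKappa s ℓ + 7 * ℓ + s + 40)

/-- `m = 64·4^s·(2κ + 8ℓ + 2s + 48)`, the validation sample size per level. [folklore] -/
def prmM (s ℓ : ℕ) : ℕ := 64 * 4 ^ s * (2 * prmKappa s ℓ + 8 * ℓ + 2 * s + 48)

/-- `q n'` = the least prime `≥ n'` (the field size of the design). [folklore] -/
def prmQ (n' : ℕ) : ℕ := Nat.find (Nat.exists_infinite_primes n')

/-- `prmQ n'` is a prime `≥ n'`. [folklore] -/
theorem prmQ_spec (n' : ℕ) : n' ≤ prmQ n' ∧ (prmQ n').Prime := Nat.find_spec (Nat.exists_infinite_primes n')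

/-- `prmQ n' ≤ 2 n'` for `n' ≥ 1` (Bertrand). [folklore] -/
theorem prmQ_le (n' : ℕ) (hn : n' ≠ 0) : prmQ n' ≤ 2 * n' := by
  obtain ⟨p, hp, hlt, hle⟩ := Nat.exists_prime_lt_and_le_two_mul n' hn
  exact (Nat.find_min' _ ⟨hlt.le, hp⟩).trans hle

/-- `prmQ` is the least prime `≥ n'`. [folklore] -/
theorem prmQ_min {n' c : ℕ} (hc : n' ≤ c) (hp : c.Prime) : prmQ n' ≤ c := Nat.find_min' _ ⟨hc, hp⟩

/-! ### Unary arithmetic bricks -/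

/-- Mathlib's unary numerals are `ones`. [folklore] -/
theorem unaryEncodeNat_eq_ones (m : ℕ) : unaryEncodeNat m = ones m := by
  induction m with
  | zero => rfl
  | succ m ih => rw [unaryEncodeNat, ih]; rfl

/-- **Capped power of two** `⟨1^C, 1ᵉ⟩ ↦ 1^{min(2^e, C)}`. [folklore] -/
noncomputable def pow2CapFn : List Bool → List Bool :=
  binToUnaryFn ∘ fanoutFn fstF (appF ∘ fanoutFn (Kannan.zerosFn ∘ sndF) (fun _ => [true]))

/-- `pow2CapFn ∈ FP`. [folklore] -/
theorem pow2CapFn_mem_FP : pow2CapFn ∈ FP :=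
  comp_mem_FP binToUnaryFn_mem_FP (fanoutFn_mem_FP fstF_mem_FP (comp_mem_FP appF_mem_FP
    (fanoutFn_mem_FP (comp_mem_FP Kannan.zerosFn_mem_FP sndF_mem_FP) (const_mem_FP _))))

/-- `bitsToNat (0ᵉ 1) = 2^e`. [folklore] -/
theorem bitsToNat_replicate_false_append_true (e : ℕ) : bitsToNat (List.replicate e false ++ [true]) = 2 ^ e := by
  induction e with
  | zero => simp [bitsToNat]
  | succ e ih => rw [List.replicate_succ, List.cons_append, bitsToNat_cons, ih, pow_succ]; simp; ring

/-- Value of `pow2CapFn`. [folklore] -/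
@[simp] theorem pow2CapFn_boolPair (r : List Bool) (e : ℕ) : pow2CapFn (boolPair r (ones e)) = ones (min (2 ^ e) r.length) := by
  rw [pow2CapFn, Function.comp_apply, fanoutFn_apply, binToUnaryFn_boolPair]
  simp [ones, bitsToNat_replicate_false_append_true]

/-- **Trial division**: the piece `[d < 2 ∨ c mod d ≠ 0]` on `⟨1ᶜ, 1ᵈ⟩`. [folklore] -/
noncomputable def trialPiece : List Bool → List Bool :=
  orFn (ltLenF ∘ fanoutFn sndF (fun _ => ones 2))
    (notFn (eqValFn ∘ fanoutFn (remFn ∘ fanoutFn (lenBinF ∘ fstF) (lenBinF ∘ sndF)) (fun _ => [])))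

/-- `trialPiece ∈ FP`. [folklore] -/
theorem trialPiece_mem_FP : trialPiece ∈ FP :=
  orFn_mem_FP (comp_mem_FP ltLenF_mem_FP (fanoutFn_mem_FP sndF_mem_FP (const_mem_FP _)))
    (notFn_mem_FP (comp_mem_FP eqValFn_mem_FP (fanoutFn_mem_FP
      (comp_mem_FP remFn_mem_FP (fanoutFn_mem_FP (comp_mem_FP lenBinF_mem_FP fstF_mem_FP) (comp_mem_FP lenBinF_mem_FP sndF_mem_FP)))
      (const_mem_FP _))))

/-- `trialPiece` is one-bit. [folklore] -/
theorem oneBit_trialPiece : OneBit trialPiece :=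
  oneBit_orFn (oneBit_ltLenF.comp _) (oneBit_notFn (oneBit_eqValFn.comp _))

/-- Value of `trialPiece`. [folklore] -/
theorem trialPiece_apply (c d : ℕ) : trialPiece (boolPair (ones c) (ones d)) = [decide (d < 2 ∨ c % d ≠ 0)] := by
  rw [trialPiece, orFn_apply (b := decide (d < 2)) (b' := decide (c % d ≠ 0))]
  · simp [Bool.decide_or]
  · simp [ones]
  · rw [notFn_apply (b := decide (c % d = 0))]
    · simp
    · simp [ones, eqValFn_boolPair, bitsToNat]

/-- **Primality by trial division** on `1ᶜ`: `[2 ≤ c ∧ ∀ d < c, d < 2 ∨ d ∤ c]`. [folklore] -/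
noncomputable def isPrimeFn : List Bool → List Bool :=
  andFn (notFn (ltLenF ∘ fanoutFn id (fun _ => ones 2)))
    (HashBricks.headBitFn ∘ sndPow 2 ∘ foldLoop Brick.andOp (clipF 1 trialPiece) X ∘
      fanoutFn id (fanoutFn lenBinF (fun _ => boolPair [] [true])))

/-- `isPrimeFn ∈ FP`. [folklore] -/
theorem isPrimeFn_mem_FP : isPrimeFn ∈ FP :=
  andFn_mem_FP (notFn_mem_FP (comp_mem_FP ltLenF_mem_FP (fanoutFn_mem_FP (PolyTimeComputable.id _) (const_mem_FP _))))
    (comp_mem_FP HashBricks.headBitFn_mem_FP (comp_mem_FP (sndPow_mem_FP 2) (comp_mem_FP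
      (foldLoop_clipF_mem_FP (d := 1) 1 Brick.andOp_mem_FP Brick.length_andOp_le trialPiece_mem_FP X)
      (fanoutFn_mem_FP (PolyTimeComputable.id _) (fanoutFn_mem_FP lenBinF_mem_FP (const_mem_FP _))))))

/-- `isPrimeFn` is one-bit. [folklore] -/
theorem oneBit_isPrimeFn : OneBit isPrimeFn := fun w => by
  rw [isPrimeFn, andFn, iteFn_of_oneBit (oneBit_notFn (oneBit_ltLenF.comp _))]
  split_ifs
  · exact ⟨_, by rw [Function.comp_apply, HashBricks.headBitFn_apply]⟩
  · exact ⟨false, rfl⟩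

/-- **Value of `isPrimeFn`**: the primality of `c`. [folklore] -/
theorem isPrimeFn_apply (c : ℕ) : isPrimeFn (ones c) = [decide c.Prime] := by
  have hc : c ≤ X.eval (ones c).length := by simp [ones]
  rw [isPrimeFn, andFn_apply (b := decide (2 ≤ c)) (b' := decide (∀ d < c, d < 2 ∨ c % d ≠ 0))]
  · rw [← Bool.decide_and]
    congr 1
    apply decide_eq_decide.2
    rw [Nat.prime_def_lt]
    refine and_congr_right fun h2 => forall_congr' fun d => imp_congr_right fun hd => ?_
    constructor
    · rintro (h | h) hdvd
      · interval_cases d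
        · exact absurd (Nat.eq_zero_of_zero_dvd hdvd) (by omega)
        · rfl
      · exact absurd (Nat.mod_eq_zero_of_dvd hdvd) h
    · intro h
      by_cases hd2 : d < 2
      · exact Or.inl hd2
      · right; intro hmod
        have := h (Nat.dvd_of_mod_eq_zero hmod); omega
  · rw [notFn_apply (b := decide (c < 2))]
    · simp only [List.cons.injEq, and_true]; by_cases h : c < 2
      · simp [h]
      · simp [h]; omega
    · simp [ones]
  · rw [Function.comp_apply, Function.comp_apply, Function.comp_apply, fanoutFn_apply, fanoutFn_apply, id, lenBinF_apply,
      show (ones c).length = c by simp [ones], show (boolPair ([] : List Bool) [true]) = boolPair (ones 0) [true] by rfl,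
      foldLoop_apply _ _ hc, foldAcc_clipF (fun d _ _ => by rw [oneBit_trialPiece.length_eq]; omega),
      Brick.foldAcc_andOp oneBit_trialPiece]
    simp only [sndPow, Function.comp_apply, sndF_boolPair, Bool.true_and, HashBricks.headBitFn_apply, List.headD_cons,
      List.cons.injEq, and_true, zero_add]
    apply decide_eq_decide.2
    refine forall_congr' fun d => imp_congr_right fun hd => ?_
    rw [trialPiece_apply]
    simp

/-- The piece of the prime search on `⟨1^{n'}, 1ᶜ⟩`: the item `⟨1ᶜ⟩` if `n' ≤ c` and `c` is prime,
nothing otherwise. [folklore] -/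
noncomputable def primePiece : List Bool → List Bool :=
  iteFn (andFn (notFn (ltLenF ∘ fanoutFn sndF fstF)) (isPrimeFn ∘ sndF))
    (fanoutFn sndF (fun _ => [])) (fun _ => [])

/-- `primePiece ∈ FP`. [folklore] -/
theorem primePiece_mem_FP : primePiece ∈ FP :=
  iteFn_mem_FP (andFn_mem_FP (notFn_mem_FP (comp_mem_FP ltLenF_mem_FP (fanoutFn_mem_FP sndF_mem_FP fstF_mem_FP)))
    (comp_mem_FP isPrimeFn_mem_FP sndF_mem_FP)) (fanoutFn_mem_FP sndF_mem_FP (const_mem_FP _))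
    (const_mem_FP _)

/-- Value of `primePiece`. [folklore] -/
theorem primePiece_apply (n' c : ℕ) :
    primePiece (boolPair (ones n') (ones c)) = if n' ≤ c ∧ c.Prime then boolPair (ones c) [] else [] := by
  rw [primePiece, iteFn_apply (b := decide (n' ≤ c ∧ c.Prime)) (by
    rw [andFn_apply (b := decide (n' ≤ c)) (b' := decide c.Prime)]
    · simp [Bool.decide_and]
    · rw [notFn_apply (b := decide (c < n'))]
      · simp only [List.cons.injEq, and_true]; by_cases h : n' ≤ c <;> simp [h, Nat.lt_of_not_le, not_lt.2]
      · simp [ones]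
    · simp [isPrimeFn_apply])]
  by_cases h : n' ≤ c ∧ c.Prime <;> simp [h]

/-- The prime-search pieces have linear length. [folklore] -/
theorem length_primePiece_le (n' c : ℕ) :
    (primePiece (boolPair (ones n') (ones c))).length ≤ 2 * c + 3 := by
  rw [primePiece_apply]; split_ifs <;> simp [length_boolPair, ones]

/-- **The least prime `≥ n'`** on `1^{n'}`: the first item of the list of the primes in
`[n', 2n'+2]` (nonempty by Bertrand's postulate). [folklore] -/
noncomputable def leastPrimeFn : List Bool → List Bool :=
  HashBricks.nthItemFn ∘ fanoutFn (fun _ => []) (sndPow 2 ∘ foldLoop appF (clipF 7 primePiece) (2 * X + 3) ∘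
    fanoutFn id (fanoutFn (lenBinF ∘ appF ∘ fanoutFn (appF ∘ fanoutFn id id) (fun _ => ones 3)) (fun _ => boolPair [] [])))

/-- `leastPrimeFn ∈ FP`. [folklore] -/
theorem leastPrimeFn_mem_FP : leastPrimeFn ∈ FP :=
  comp_mem_FP HashBricks.nthItemFn_mem_FP (fanoutFn_mem_FP (const_mem_FP _) (comp_mem_FP (sndPow_mem_FP 2) (comp_mem_FP
    (foldLoop_clipF_mem_FP 7 appF_mem_FP length_appF_le primePiece_mem_FP (2 * X + 3))
    (fanoutFn_mem_FP (PolyTimeComputable.id _) (fanoutFn_mem_FP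
      (comp_mem_FP lenBinF_mem_FP (comp_mem_FP appF_mem_FP (fanoutFn_mem_FP
        (comp_mem_FP appF_mem_FP (fanoutFn_mem_FP (PolyTimeComputable.id _) (PolyTimeComputable.id _))) (const_mem_FP _))))
      (const_mem_FP _))))))

/-- The increasing list of the primes `p` with `n' ≤ p < M`. [folklore] -/
def primesFrom (n' M : ℕ) : List ℕ := (List.range M).filter fun c => decide (n' ≤ c ∧ c.Prime)

/-- `boolPair x (y ++ z) = boolPair x y ++ z`. [folklore] -/
theorem boolPair_append_right (x y z : List Bool) : boolPair x (y ++ z) = boolPair x y ++ z := by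
  simp [boolPair, List.append_assoc]

/-- `body (l ++ [a]) = body l ++ boolPair a []`. [folklore] -/
theorem body_append_singleton (l : List (List Bool)) (a : List Bool) :
    OracleCompose.body (l ++ [a]) = OracleCompose.body l ++ boolPair a [] := by
  induction l with
  | nil => rfl
  | cons x l ih => rw [List.cons_append, OracleCompose.body_cons, ih, OracleCompose.body_cons, boolPair_append_right]

/-- The concatenated prime-search pieces form the list code of `primesFrom`. [folklore] -/
theorem ccat_primePiece (n' : ℕ) : ∀ M : ℕ,
    ccat (fun c => primePiece (boolPair (ones n') (ones c))) M = OracleCompose.body ((primesFrom n' M).map ones)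
  | 0 => by simp [primesFrom]
  | M + 1 => by
    rw [ccat_succ, ccat_primePiece n' M, primePiece_apply]
    unfold primesFrom
    rw [List.range_succ, List.filter_append, List.map_append]
    by_cases h : n' ≤ M ∧ M.Prime
    · rw [if_pos h, List.filter_singleton, decide_eq_true h]
      simp [body_append_singleton]
    · rw [if_neg h, List.filter_singleton, decide_eq_false h]
      simp

/-- The head of `primesFrom n' (2n'+3)` is `prmQ n'`. [folklore] -/
theorem primesFrom_head (n' : ℕ) : (primesFrom n' (2 * n' + 3)).head? = some (prmQ n') := by
  obtain ⟨hq1, hq2⟩ := prmQ_spec n'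
  have hqM : prmQ n' < 2 * n' + 3 := by
    rcases Nat.eq_zero_or_pos n' with h0 | hpos
    · subst h0
      have : prmQ 0 ≤ 2 := prmQ_min (Nat.zero_le _) Nat.prime_two
      omega
    · have := prmQ_le n' hpos.ne'
      omega
  have hsplit : List.range (2 * n' + 3) = List.range (prmQ n') ++ List.range' (prmQ n') (2 * n' + 3 - prmQ n') := by
    have happ : List.range' 0 (prmQ n') ++ List.range' (0 + 1 * prmQ n') (2 * n' + 3 - prmQ n') =
        List.range' 0 (prmQ n' + (2 * n' + 3 - prmQ n')) := List.range'_append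
    rw [List.range_eq_range', List.range_eq_range', show 2 * n' + 3 = prmQ n' + (2 * n' + 3 - prmQ n') by omega, ← happ]
    simp
  have hnil : (List.range (prmQ n')).filter (fun c => decide (n' ≤ c ∧ c.Prime)) = [] := by
    rw [List.filter_eq_nil_iff]
    intro c hc
    rw [List.mem_range] at hc
    simp only [decide_eq_true_eq, not_and]
    intro hle hp
    exact absurd (prmQ_min hle hp) (not_le.2 hc)
  rw [primesFrom, hsplit, List.filter_append, hnil, List.nil_append,
    show 2 * n' + 3 - prmQ n' = (2 * n' + 3 - prmQ n' - 1) + 1 by omega, List.range'_succ,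
    List.filter_cons_of_pos (by simp [hq1, hq2])]
  rfl

/-- **Value of `leastPrimeFn`**: `1^{prmQ n'}`. [folklore] -/
theorem leastPrimeFn_apply (n' : ℕ) : leastPrimeFn (ones n') = ones (prmQ n') := by
  have hM : 2 * n' + 3 ≤ (2 * X + 3 : Polynomial ℕ).eval (ones n').length := by simp [ones]
  rw [leastPrimeFn, Function.comp_apply, fanoutFn_apply, Function.comp_apply, Function.comp_apply, fanoutFn_apply,
    fanoutFn_apply, id]
  simp only [Function.comp_apply, fanoutFn_apply, id, appF_boolPair, lenBinF_apply, List.length_append]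
  rw [show (ones n').length + (ones n').length + (ones 3).length = 2 * n' + 3 by simp [ones]; ring,
    show (boolPair ([] : List Bool) []) = boolPair (ones 0) ([] : List Bool) by rfl,
    foldLoop_apply _ _ hM, foldAcc_clipF (fun c _ hc => (length_primePiece_le n' c).trans (by
      simp only [ones, List.length_replicate, zero_add] at hc ⊢; omega)), foldAcc_appF]
  simp only [sndPow, Function.comp_apply, sndF_boolPair, zero_add, List.nil_append, ccat_primePiece]
  rw [show ([] : List Bool) = ones 0 from rfl, HashBricks.nthItemFn_body, List.getD_eq_getElem?_getD, List.getElem?_map,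
    ← List.head?_eq_getElem?, primesFrom_head]
  rfl

/-! ### The parameter bricks on the learner's argument `⟨x, 1^ℓ⟩` -/

/-- `onesFn w = 1^{|w|}`. [folklore] -/
@[simp] theorem onesFn_eq_ones (w : List Bool) : onesFn w = ones w.length := by
  rw [onesFn, unaryEncodeNat_eq_ones]

/-- `ones a ++ ones b = ones (a + b)`. [folklore] -/
@[simp] theorem ones_append_ones (a b : ℕ) : ones a ++ ones b = ones (a + b) := by
  simp [ones, List.replicate_append_replicate]

/-- `|ones a| = a`. [folklore] -/
@[simp] theorem length_ones (a : ℕ) : (ones a).length = a := by simp [ones]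

/-- The learner's argument at level `ℓ`: `⟨⟨pacParams n a b, r⟩, 1^ℓ⟩`. [folklore] -/
def lrnArg (n a b : ℕ) (r : List Bool) (ℓ : ℕ) : List Bool := boolPair (boolPair (pacParams n a b) r) (ones ℓ)

/-- `1^{n+a+b+2}` on `⟨x, 1^ℓ⟩`, `x = ⟨⟨1ⁿ, ⟨1ᵃ, 1ᵇ⟩⟩, r⟩`. [folklore] -/
noncomputable def bigNFn : List Bool → List Bool :=
  (appF ∘ (fanoutFn (nthF 0 ∘ (fstF ∘ fstF)) (appF ∘ (fanoutFn (nthF 1 ∘ (fstF ∘ fstF)) (appF ∘ (fanoutFn (sndPow 1 ∘ (fstF ∘ fstF)) (fun _ => ones 2)))))))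

/-- `bigNFn ∈ FP`. [folklore] -/
theorem bigNFn_mem_FP : bigNFn ∈ FP :=
  (comp_mem_FP appF_mem_FP (fanoutFn_mem_FP (comp_mem_FP (nthF_mem_FP 0) (comp_mem_FP fstF_mem_FP fstF_mem_FP)) (comp_mem_FP appF_mem_FP (fanoutFn_mem_FP (comp_mem_FP (nthF_mem_FP 1) (comp_mem_FP fstF_mem_FP fstF_mem_FP)) (comp_mem_FP appF_mem_FP (fanoutFn_mem_FP (comp_mem_FP (sndPow_mem_FP 1) (comp_mem_FP fstF_mem_FP fstF_mem_FP)) (const_mem_FP _)))))))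

/-- `1ˢ`, `s = size₂(n+a+b+2)`. [folklore] -/
noncomputable def sFn : List Bool → List Bool :=
  (onesFn ∘ (lenBinF ∘ bigNFn))

/-- `sFn ∈ FP`. [folklore] -/
theorem sFn_mem_FP : sFn ∈ FP :=
  (comp_mem_FP onesFn_mem_FP (comp_mem_FP lenBinF_mem_FP bigNFn_mem_FP))

/-- `1^κ`, `κ = 3s + size₂ ℓ + 30`. [folklore] -/
noncomputable def kappaFn : List Bool → List Bool :=
  (appF ∘ (fanoutFn (HashBricks.umulFn ∘ (fanoutFn (fun _ => ones 3) sFn)) (appF ∘ (fanoutFn (onesFn ∘ (lenBinF ∘ sndF)) (fun _ => ones 30)))))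

/-- `kappaFn ∈ FP`. [folklore] -/
theorem kappaFn_mem_FP : kappaFn ∈ FP :=
  (comp_mem_FP appF_mem_FP (fanoutFn_mem_FP (comp_mem_FP HashBricks.umulFn_mem_FP (fanoutFn_mem_FP (const_mem_FP _) sFn_mem_FP)) (comp_mem_FP appF_mem_FP (fanoutFn_mem_FP (comp_mem_FP onesFn_mem_FP (comp_mem_FP lenBinF_mem_FP sndF_mem_FP)) (const_mem_FP _)))))

/-- `1ᵏ` (capped at `|r|`), `k = 2^κ`. [folklore] -/
noncomputable def kFn : List Bool → List Bool :=
  (pow2CapFn ∘ (fanoutFn (sndF ∘ fstF) kappaFn))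

/-- `kFn ∈ FP`. [folklore] -/
theorem kFn_mem_FP : kFn ∈ FP :=
  (comp_mem_FP pow2CapFn_mem_FP (fanoutFn_mem_FP (comp_mem_FP sndF_mem_FP fstF_mem_FP) kappaFn_mem_FP))

/-- `1ᴸ` (capped at `|r|`), `L = 2^ℓ`. [folklore] -/
noncomputable def bigLFn : List Bool → List Bool :=
  (pow2CapFn ∘ (fanoutFn (sndF ∘ fstF) sndF))

/-- `bigLFn ∈ FP`. [folklore] -/
theorem bigLFn_mem_FP : bigLFn ∈ FP :=
  (comp_mem_FP pow2CapFn_mem_FP (fanoutFn_mem_FP (comp_mem_FP sndF_mem_FP fstF_mem_FP) sndF_mem_FP))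

/-- `1^kk`, `kk = κ + 2ℓ + 8`. [folklore] -/
noncomputable def kkFn : List Bool → List Bool :=
  (appF ∘ (fanoutFn kappaFn (appF ∘ (fanoutFn (HashBricks.umulFn ∘ (fanoutFn (fun _ => ones 2) sndF)) (fun _ => ones 8)))))

/-- `kkFn ∈ FP`. [folklore] -/
theorem kkFn_mem_FP : kkFn ∈ FP :=
  (comp_mem_FP appF_mem_FP (fanoutFn_mem_FP kappaFn_mem_FP (comp_mem_FP appF_mem_FP (fanoutFn_mem_FP (comp_mem_FP HashBricks.umulFn_mem_FP (fanoutFn_mem_FP (const_mem_FP _) sndF_mem_FP)) (const_mem_FP _)))))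

/-- `1^{2^kk}` (capped at `|r|`). [folklore] -/
noncomputable def bigKKFn : List Bool → List Bool :=
  (pow2CapFn ∘ (fanoutFn (sndF ∘ fstF) kkFn))

/-- `bigKKFn ∈ FP`. [folklore] -/
theorem bigKKFn_mem_FP : bigKKFn ∈ FP :=
  (comp_mem_FP pow2CapFn_mem_FP (fanoutFn_mem_FP (comp_mem_FP sndF_mem_FP fstF_mem_FP) kkFn_mem_FP))

/-- `1ᵗ` (capped at `|r|`), `t = 2^{κ+3ℓ+s+22}`. [folklore] -/
noncomputable def tFn : List Bool → List Bool :=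
  (pow2CapFn ∘ (fanoutFn (sndF ∘ fstF) (appF ∘ (fanoutFn kappaFn (appF ∘ (fanoutFn (HashBricks.umulFn ∘ (fanoutFn (fun _ => ones 3) sndF)) (appF ∘ (fanoutFn sFn (fun _ => ones 22)))))))))

/-- `tFn ∈ FP`. [folklore] -/
theorem tFn_mem_FP : tFn ∈ FP :=
  (comp_mem_FP pow2CapFn_mem_FP (fanoutFn_mem_FP (comp_mem_FP sndF_mem_FP fstF_mem_FP) (comp_mem_FP appF_mem_FP (fanoutFn_mem_FP kappaFn_mem_FP (comp_mem_FP appF_mem_FP (fanoutFn_mem_FP (comp_mem_FP HashBricks.umulFn_mem_FP (fanoutFn_mem_FP (const_mem_FP _) sndF_mem_FP)) (comp_mem_FP appF_mem_FP (fanoutFn_mem_FP sFn_mem_FP (const_mem_FP _)))))))))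

/-- `1^Reps` (capped at `|r|`), `Reps = 2^{2κ+7ℓ+s+40}`. [folklore] -/
noncomputable def repsFn : List Bool → List Bool :=
  (pow2CapFn ∘ (fanoutFn (sndF ∘ fstF) (appF ∘ (fanoutFn (HashBricks.umulFn ∘ (fanoutFn (fun _ => ones 2) kappaFn)) (appF ∘ (fanoutFn (HashBricks.umulFn ∘ (fanoutFn (fun _ => ones 7) sndF)) (appF ∘ (fanoutFn sFn (fun _ => ones 40)))))))))

/-- `repsFn ∈ FP`. [folklore] -/
theorem repsFn_mem_FP : repsFn ∈ FP :=
  (comp_mem_FP pow2CapFn_mem_FP (fanoutFn_mem_FP (comp_mem_FP sndF_mem_FP fstF_mem_FP) (comp_mem_FP appF_mem_FP (fanoutFn_mem_FP (comp_mem_FP HashBricks.umulFn_mem_FP (fanoutFn_mem_FP (const_mem_FP _) kappaFn_mem_FP)) (comp_mem_FP appF_mem_FP (fanoutFn_mem_FP (comp_mem_FP HashBricks.umulFn_mem_FP (fanoutFn_mem_FP (const_mem_FP _) sndF_mem_FP)) (comp_mem_FP appF_mem_FP (fanoutFn_mem_FP sFn_mem_FP (const_mem_FP _)))))))))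

/-- `1ᵐ`, `m = 64·4^s·(2κ+8ℓ+2s+48)` (`2^s ≤ 2(n+a+b+2)`, no cap needed). [folklore] -/
noncomputable def mFn : List Bool → List Bool :=
  (HashBricks.umulFn ∘ (fanoutFn (HashBricks.umulFn ∘ (fanoutFn (fun _ => ones 64) (HashBricks.umulFn ∘ (fanoutFn (pow2CapFn ∘ (fanoutFn (appF ∘ (fanoutFn bigNFn bigNFn)) sFn)) (pow2CapFn ∘ (fanoutFn (appF ∘ (fanoutFn bigNFn bigNFn)) sFn)))))) (appF ∘ (fanoutFn (HashBricks.umulFn ∘ (fanoutFn (fun _ => ones 2) kappaFn)) (appF ∘ (fanoutFn (HashBricks.umulFn ∘ (fanoutFn (fun _ => ones 8) sndF)) (appF ∘ (fanoutFn (HashBricks.umulFn ∘ (fanoutFn (fun _ => ones 2) sFn)) (fun _ => ones 48)))))))))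

/-- `mFn ∈ FP`. [folklore] -/
theorem mFn_mem_FP : mFn ∈ FP :=
  (comp_mem_FP HashBricks.umulFn_mem_FP (fanoutFn_mem_FP (comp_mem_FP HashBricks.umulFn_mem_FP (fanoutFn_mem_FP (const_mem_FP _) (comp_mem_FP HashBricks.umulFn_mem_FP (fanoutFn_mem_FP (comp_mem_FP pow2CapFn_mem_FP (fanoutFn_mem_FP (comp_mem_FP appF_mem_FP (fanoutFn_mem_FP bigNFn_mem_FP bigNFn_mem_FP)) sFn_mem_FP)) (comp_mem_FP pow2CapFn_mem_FP (fanoutFn_mem_FP (comp_mem_FP appF_mem_FP (fanoutFn_mem_FP bigNFn_mem_FP bigNFn_mem_FP)) sFn_mem_FP)))))) (comp_mem_FP appF_mem_FP (fanoutFn_mem_FP (comp_mem_FP HashBricks.umulFn_mem_FP (fanoutFn_mem_FP (const_mem_FP _) kappaFn_mem_FP)) (comp_mem_FP appF_mem_FP (fanoutFn_mem_FP (comp_mem_FP HashBricks.umulFn_mem_FP (fanoutFn_mem_FP (const_mem_FP _) sndF_mem_FP)) (comp_mem_FP appF_mem_FP (fanoutFn_mem_FP (comp_mem_FP HashBricks.umulFn_mem_FP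 (fanoutFn_mem_FP (const_mem_FP _) sFn_mem_FP)) (const_mem_FP _)))))))))

/-- `1^{n'}`, `n' = kn + k`. [folklore] -/
noncomputable def nPrimeFn : List Bool → List Bool :=
  (appF ∘ (fanoutFn (HashBricks.umulFn ∘ (fanoutFn kFn (nthF 0 ∘ (fstF ∘ fstF)))) kFn))

/-- `nPrimeFn ∈ FP`. [folklore] -/
theorem nPrimeFn_mem_FP : nPrimeFn ∈ FP :=
  (comp_mem_FP appF_mem_FP (fanoutFn_mem_FP (comp_mem_FP HashBricks.umulFn_mem_FP (fanoutFn_mem_FP kFn_mem_FP (comp_mem_FP (nthF_mem_FP 0) (comp_mem_FP fstF_mem_FP fstF_mem_FP)))) kFn_mem_FP))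

/-- `1^q`, `q` the least prime `≥ n'`. [folklore] -/
noncomputable def qFn : List Bool → List Bool :=
  (leastPrimeFn ∘ nPrimeFn)

/-- `qFn ∈ FP`. [folklore] -/
theorem qFn_mem_FP : qFn ∈ FP :=
  (comp_mem_FP leastPrimeFn_mem_FP nPrimeFn_mem_FP)


section Values

variable (n a b : ℕ) (r : List Bool) (ℓ : ℕ)

/-- Accessors on `lrnArg`. [folklore] -/
theorem lrnArg_fields :
    sndF (lrnArg n a b r ℓ) = ones ℓ ∧ sndF (fstF (lrnArg n a b r ℓ)) = r ∧
      nthF 0 (fstF (fstF (lrnArg n a b r ℓ))) = ones n ∧ nthF 1 (fstF (fstF (lrnArg n a b r ℓ))) = ones a ∧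
      sndPow 1 (fstF (fstF (lrnArg n a b r ℓ))) = ones b := by
  simp [lrnArg, pacParams, nthF, sndPow, unaryEncodeNat_eq_ones]

/-- Value of `bigNFn`. [folklore] -/
@[simp] theorem bigNFn_apply : bigNFn (lrnArg n a b r ℓ) = ones (n + a + b + 2) := by
  obtain ⟨h1, h2, h3, h4, h5⟩ := lrnArg_fields n a b r ℓ
  simp only [bigNFn, Function.comp_apply, fanoutFn_apply, h3, h4, h5, appF_boolPair, ones_append_ones]
  exact congrArg ones (by omega)

/-- Value of `sFn`. [folklore] -/
@[simp] theorem sFn_apply : sFn (lrnArg n a b r ℓ) = ones (prmS n a b) := by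
  simp only [sFn, Function.comp_apply, bigNFn_apply, lenBinF_apply, length_ones, onesFn_eq_ones,
    TM2Pass.length_encodeNat_eq_size, prmS]

/-- Value of `kappaFn`. [folklore] -/
@[simp] theorem kappaFn_apply : kappaFn (lrnArg n a b r ℓ) = ones (prmKappa (prmS n a b) ℓ) := by
  obtain ⟨h1, h2, h3, h4, h5⟩ := lrnArg_fields n a b r ℓ
  simp only [kappaFn, Function.comp_apply, fanoutFn_apply, sFn_apply, h1, lenBinF_apply, length_ones, onesFn_eq_ones,
    TM2Pass.length_encodeNat_eq_size, HashBricks.umulFn_boolPair, appF_boolPair, ones_append_ones, prmKappa]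
  exact congrArg ones (by omega)

/-- Value of `kFn`. [folklore] -/
@[simp] theorem kFn_apply : kFn (lrnArg n a b r ℓ) = ones (min (prmK (prmS n a b) ℓ) r.length) := by
  obtain ⟨h1, h2, h3, h4, h5⟩ := lrnArg_fields n a b r ℓ
  simp only [kFn, Function.comp_apply, fanoutFn_apply, kappaFn_apply, h2, pow2CapFn_boolPair, prmK]

/-- Value of `bigLFn`. [folklore] -/
@[simp] theorem bigLFn_apply : bigLFn (lrnArg n a b r ℓ) = ones (min (2 ^ ℓ) r.length) := by
  obtain ⟨h1, h2, h3, h4, h5⟩ := lrnArg_fields n a b r ℓ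
  simp only [bigLFn, Function.comp_apply, fanoutFn_apply, h1, h2, pow2CapFn_boolPair]

/-- Value of `kkFn`. [folklore] -/
@[simp] theorem kkFn_apply : kkFn (lrnArg n a b r ℓ) = ones (prmKK (prmS n a b) ℓ) := by
  obtain ⟨h1, h2, h3, h4, h5⟩ := lrnArg_fields n a b r ℓ
  simp only [kkFn, Function.comp_apply, fanoutFn_apply, kappaFn_apply, h1, HashBricks.umulFn_boolPair, appF_boolPair,
    ones_append_ones, prmKK]
  exact congrArg ones (by omega)

/-- Value of `bigKKFn`. [folklore] -/
@[simp] theorem bigKKFn_apply : bigKKFn (lrnArg n a b r ℓ) = ones (min (2 ^ prmKK (prmS n a b) ℓ) r.length) := by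
  obtain ⟨h1, h2, h3, h4, h5⟩ := lrnArg_fields n a b r ℓ
  simp only [bigKKFn, Function.comp_apply, fanoutFn_apply, kkFn_apply, h2, pow2CapFn_boolPair]

/-- Value of `tFn`. [folklore] -/
@[simp] theorem tFn_apply : tFn (lrnArg n a b r ℓ) = ones (min (prmT (prmS n a b) ℓ) r.length) := by
  obtain ⟨h1, h2, h3, h4, h5⟩ := lrnArg_fields n a b r ℓ
  simp only [tFn, Function.comp_apply, fanoutFn_apply, kappaFn_apply, sFn_apply, h1, h2, HashBricks.umulFn_boolPair,
    appF_boolPair, ones_append_ones, pow2CapFn_boolPair, prmT]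
  exact congrArg (fun e => ones (min (2 ^ e) r.length)) (by omega)

/-- Value of `repsFn`. [folklore] -/
@[simp] theorem repsFn_apply : repsFn (lrnArg n a b r ℓ) = ones (min (prmReps (prmS n a b) ℓ) r.length) := by
  obtain ⟨h1, h2, h3, h4, h5⟩ := lrnArg_fields n a b r ℓ
  simp only [repsFn, Function.comp_apply, fanoutFn_apply, kappaFn_apply, sFn_apply, h1, h2, HashBricks.umulFn_boolPair,
    appF_boolPair, ones_append_ones, pow2CapFn_boolPair, prmReps]
  exact congrArg (fun e => ones (min (2 ^ e) r.length)) (by omega)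

/-- `2^s ≤ 2 (n + a + b + 2)`. [folklore] -/
theorem two_pow_prmS_le : 2 ^ prmS n a b ≤ n + a + b + 2 + (n + a + b + 2) := by
  rw [prmS]
  have hpos : 0 < Nat.size (n + a + b + 2) := Nat.size_pos.2 (by omega)
  have h2 : 2 ^ (Nat.size (n + a + b + 2) - 1) ≤ n + a + b + 2 := Nat.lt_size.1 (by omega)
  calc 2 ^ Nat.size (n + a + b + 2) = 2 * 2 ^ (Nat.size (n + a + b + 2) - 1) := by
        rw [← pow_succ']; congr 1; omega
    _ ≤ _ := by omega

/-- Value of `mFn`. [folklore] -/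
@[simp] theorem mFn_apply : mFn (lrnArg n a b r ℓ) = ones (prmM (prmS n a b) ℓ) := by
  obtain ⟨h1, h2, h3, h4, h5⟩ := lrnArg_fields n a b r ℓ
  have hcap : min (2 ^ prmS n a b) (ones (n + a + b + 2 + (n + a + b + 2))).length = 2 ^ prmS n a b := by
    rw [length_ones]; exact min_eq_left (two_pow_prmS_le n a b)
  simp only [mFn, Function.comp_apply, fanoutFn_apply, kappaFn_apply, sFn_apply, bigNFn_apply, h1, HashBricks.umulFn_boolPair,
    appF_boolPair, ones_append_ones, pow2CapFn_boolPair, prmM]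
  rw [hcap]
  refine congrArg ones ?_
  rw [show (4 : ℕ) ^ prmS n a b = 2 ^ prmS n a b * 2 ^ prmS n a b by rw [← mul_pow]; norm_num]
  generalize 2 ^ prmS n a b * 2 ^ prmS n a b = A
  generalize prmKappa (prmS n a b) ℓ = B
  ring

/-- Value of `nPrimeFn` (when `k ≤ |r|`). [folklore] -/
theorem nPrimeFn_apply (hk : prmK (prmS n a b) ℓ ≤ r.length) :
    nPrimeFn (lrnArg n a b r ℓ) = ones (prmK (prmS n a b) ℓ * n + prmK (prmS n a b) ℓ) := by
  obtain ⟨h1, h2, h3, h4, h5⟩ := lrnArg_fields n a b r ℓ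
  simp only [nPrimeFn, Function.comp_apply, fanoutFn_apply, kFn_apply, min_eq_left hk, h3, HashBricks.umulFn_boolPair,
    appF_boolPair, ones_append_ones]

/-- Value of `qFn` (when `k ≤ |r|`). [folklore] -/
theorem qFn_apply (hk : prmK (prmS n a b) ℓ ≤ r.length) :
    qFn (lrnArg n a b r ℓ) = ones (prmQ (prmK (prmS n a b) ℓ * n + prmK (prmS n a b) ℓ)) := by
  rw [qFn, Function.comp_apply, nPrimeFn_apply n a b r ℓ hk, leastPrimeFn_apply]

end Values

end Literature.Computability.Learning
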